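import Summits.ValiantsHypothesis.ValiantsHypothesis.Theses.BarrierLever
import Summits.ValiantsHypothesis.ValiantsHypothesis.Theorems.BarrierLeverIntegerBoxVanishingTransfer
import Literature.ModelTheory.FiniteModelTheory.SymmetricCircuitCountingWidthProofs

/-!
# Route BarrierLever — item 20037 `BoxTransferAtQuadraticExponent` (coefficient axis of the V4 door)

Item `stmt-ValiantsHypothesis-20037` (support, rank 9; planner p2-g7, cell valiant-natproofs, rung V4;
UNCONDITIONAL — the upper end of the transfer-threshold bracket, companion of `NoBoxTransferBelowLevel`).
TRANSFER AT QUADRATIC BOX EXPONENT: for all `a, b` there is `n₀` such that for `n ≥ n₀` every level-`a`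
distinguisher that vanishes at every `f ∈ SmallCircuits ℂ n (5b+23)` with INTEGER coefficients of modulus
`≤ N^{(a+1)(2n+1)}` (`N = C(2n,n)`) vanishes on ALL of `SmallCircuits ℂ n b`.

**Proof** (planner p2-g7's, re-derived because the attached scratch is not readable from a prover jail):
the closed item 20033 (`IntSlice.integerBoxVanishingTransfer`, box magnitude
`((n + n·wd)·N^a·(n+1))^{2n+1}`, Raz width `wd = 4(n+1)(n^b+n+2)(n+1)²`, threshold
`n ≥ 21876·2^{5b+21}+1`) restated in box-exponent units: `(n + n·wd)(n+1) ≤ 130·n^{b+6} ≤ 2^n ≤ C(2n,n)`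
for all large `n`, so 20033's box sits inside magnitude `N^{(a+1)(2n+1)}` and the hypothesis of this item
implies 20033's hypothesis.

WHAT THIS IS NOT: nothing on FSV Question 6 / crux stmt-ValiantsHypothesis-14610 or on VP vs VNP.
-/

-- layout Summits/ValiantsHypothesis/ValiantsHypothesis forces the duplicated namespace component
set_option linter.dupNamespace false

namespace Summit.ValiantsHypothesis.ValiantsHypothesis.Theorems.BarrierLever.CoeffAxis

open MvPolynomial Literature.Barriers.ValiantsHypothesis

/-! ## 1. Growth: a polynomial is eventually below `2^n` (and `2^n ≤ C(2n,n)` is the tree's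
`Literature.ModelTheory.FiniteModelTheory.two_pow_le_choose_two_mul_self`) -/

/-- `C · n^k ≤ 2^n` for all large `n` (from `n^k / 2^n → 0`; adapted from the private lemma of
`Literature…CKRST20IntegerBoxNaturalProofs`). -/
theorem eventually_mul_pow_le_two_pow (C k : ℕ) : ∃ n₀ : ℕ, ∀ n ≥ n₀, C * n ^ k ≤ 2 ^ n := by
  have h := tendsto_pow_const_div_const_pow_of_one_lt k (one_lt_two : (1 : ℝ) < 2)
  have hev := h.eventually (gt_mem_nhds (show (0 : ℝ) < 1 / ((C : ℝ) + 1) by positivity))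
  rw [Filter.eventually_atTop] at hev
  obtain ⟨n₀, hn₀⟩ := hev
  refine ⟨n₀, fun n hn => ?_⟩
  have h1 := hn₀ n hn
  rw [div_lt_iff₀ (by positivity)] at h1
  have h2 : ((C : ℝ) + 1) * (n : ℝ) ^ k < (2 : ℝ) ^ n := by
    have := mul_lt_mul_of_pos_left h1 (show (0 : ℝ) < C + 1 by positivity)
    rwa [← mul_assoc, mul_one_div_cancel (by positivity), one_mul] at this
  have h3 : ((C * n ^ k : ℕ) : ℝ) ≤ ((2 ^ n : ℕ) : ℝ) := by
    push_cast
    nlinarith [show (0 : ℝ) ≤ (n : ℝ) ^ k by positivity]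
  exact_mod_cast h3

/-- The Raz-width factor of item 20033 is polynomial: `(n + n·wd)(n+1) ≤ 130·n^{b+6}` for `n ≥ 3`. -/
theorem width_factor_le (n b : ℕ) (hn : 3 ≤ n) :
    (n + n * (4 * ((n + 1) * (n ^ b + n + 2)) * (n + 1) ^ 2)) * (n + 1) ≤ 130 * n ^ (b + 6) := by
  have h1 : n + 1 ≤ 2 * n := by omega
  have hb1 : 1 ≤ n ^ b := Nat.one_le_pow _ _ (by omega)
  have h2 : n ^ b + n + 2 ≤ n ^ b * (2 * n) := by
    have e1 : n ≤ n ^ b * n := Nat.le_mul_of_pos_left _ (by omega)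
    have e2 : 3 * n ^ b ≤ n ^ b * n := by rw [mul_comm]; exact Nat.mul_le_mul_left _ hn
    nlinarith [e1, e2, hb1]
  have h3 : n ^ 2 ≤ n ^ (b + 6) := Nat.pow_le_pow_right (by omega) (by omega)
  calc (n + n * (4 * ((n + 1) * (n ^ b + n + 2)) * (n + 1) ^ 2)) * (n + 1)
      ≤ (n + n * (4 * ((2 * n) * (n ^ b * (2 * n))) * (2 * n) ^ 2)) * (2 * n) := by
        gcongr
    _ = 2 * n ^ 2 + 128 * n ^ (b + 6) := by ring
    _ ≤ 130 * n ^ (b + 6) := by omega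

/-! ## 2. The item -/

/-- **Item 20037 `BoxTransferAtQuadraticExponent`** (the route decl, by name). -/
theorem boxTransferAtQuadraticExponent : Theses.BarrierLever.BoxTransferAtQuadraticExponent := by
  intro a b
  obtain ⟨n₁, hn₁⟩ := eventually_mul_pow_le_two_pow 130 (b + 6)
  refine ⟨max (21876 * 2 ^ (5 * b + 21) + 1) (max n₁ 3), fun n hn D hD hbox => ?_⟩
  have hn0 : 21876 * 2 ^ (5 * b + 21) + 1 ≤ n := (le_max_left _ _).trans hn
  have hn1 : n₁ ≤ n := ((le_max_left _ _).trans (le_max_right _ _)).trans hn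
  have hn3 : 3 ≤ n := ((le_max_right _ _).trans (le_max_right _ _)).trans hn
  -- the width factor is below `N = C(2n, n)`
  have hN : (n + n * (4 * ((n + 1) * (n ^ b + n + 2)) * (n + 1) ^ 2)) * (n + 1) ≤
      (2 * n).choose n :=
    (width_factor_le n b hn3).trans ((hn₁ n hn1).trans
      (Literature.ModelTheory.FiniteModelTheory.two_pow_le_choose_two_mul_self n))
  -- hence 20033's box sits inside the box of magnitude `N^{(a+1)(2n+1)}`
  have hB : ((n + n * (4 * ((n + 1) * (n ^ b + n + 2)) * (n + 1) ^ 2)) *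
      ((2 * n).choose n ^ a * (n + 1))) ^ (2 * n + 1) ≤
      (2 * n).choose n ^ ((a + 1) * (2 * n + 1)) := by
    rw [pow_mul]
    apply Nat.pow_le_pow_left
    calc (n + n * (4 * ((n + 1) * (n ^ b + n + 2)) * (n + 1) ^ 2)) * ((2 * n).choose n ^ a * (n + 1))
        = ((n + n * (4 * ((n + 1) * (n ^ b + n + 2)) * (n + 1) ^ 2)) * (n + 1)) *
            (2 * n).choose n ^ a := by ring
      _ ≤ (2 * n).choose n * (2 * n).choose n ^ a := Nat.mul_le_mul_right _ hN
      _ = (2 * n).choose n ^ (a + 1) := by ring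
  refine IntSlice.integerBoxVanishingTransfer a b n hn0 D hD (fun f hf hf' => hbox f hf (fun m => ?_))
  obtain ⟨z, hz, hzle⟩ := hf' m
  exact ⟨z, hz, hzle.trans (by exact_mod_cast hB)⟩

end Summit.ValiantsHypothesis.ValiantsHypothesis.Theorems.BarrierLever.CoeffAxis
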